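import Summits.QuantumFields.YangMills.Theorems.PoincareLipschitzSobolevCubeExtractionLetters
import HarnessLib

/-!
# Crux `BlockLipschitzL` (stmt-QuantumFields-23533) ∕ `HistoryTailL` (stmt-QuantumFields-19936), LINE 25 «CompactnessTransfer»,
# (C)-PROOF brick (C-a3) «EXTRACTION ON THE CUBE: STRONG `L²` LIMIT, WEAK GRADIENT, ENERGY BOUND, LOWER SEMICONTINUITY»

Cell `ym3-torus` (YM ladder rung R3 = continuum SU(2) Yang–Mills on T³ — a RUNG, NOT the Clay problem: not d = 4, not
infinite volume, not a mass gap); WIDTH helper seat `ym-ust-19936-w2` g13, (C)-PROOF lineage project (LEAD GO 13:49Z).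
Helper `--supports stmt-QuantumFields-23533`; THEOREMS ONLY (0 `def`, 0 `sorry`, default heartbeats); imports: (C-a2)
✓`PoincareLipschitzSobolevL2Compactness`, ★w8's ✓`PoincareLipschitzDyadicMeansWeakLimitCube` (weak `L²` limits from dyadic
means), px3's ✓`PoincareLipschitzLatticeToContinuumSobolevLetters` (`exists_unit_representative`, `hasWeakFDerivOn_congr_ae`),
LEAD's ✓`PoincareLipschitzBlowDownWeakGradientLetters` (`sum_smulRight_apply`), lit ✓`DiagonalWeakLimits`.

WHAT THIS FILE DOES — the continuum twin of Γ1 ⊕ Γ2-W ⊕ Γ2-IBP for sequences of maps (not blow-downs): for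
`u_j : Q → S³` (`Q` the open unit cube of `ℝ³`) with weak gradients `Gs_j` on `Q` and energies `∫_Q Σ_i‖Gs_j e_i‖² ≤ Λ`,
★★★ `exists_subseq_limit_weakGrad`: a subsequence `φ`, a UNIT map `U` with weak gradient `G` on `Q`, `∫_Q Σ_i‖G e_i‖² ≤ Λ`,
`‖u_{φ j} − U‖_{L²(Q)} → 0`, and LOWER SEMICONTINUITY of the energy on every measurable `S ⊆ Q` in the frequently-form
`(∃ᶠ j, ∫_S dens(Gs_{φ j}) ≤ M) → ∫_S dens(G) ≤ M`.  Proof: (C-a2) for the strong `L²(Q)` limit (values bounded by `1`,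
`‖Gs_j‖_{L²} ≤ √Λ`); px3's unit representative; diagonal extraction of the dyadic means of the three fields `Gs_j e_i`
(lit `exists_strictMono_forall_tendsto`) and ★w8's weak limits `G_i`; `G := Σ_i proj_i ⊗ G_i`; the integration-by-parts
identity passes to the limit (strong `L²` on the left, ★w8's bounded-multiplier pairings on the right); the energy
bounds by Cauchy–Schwarz absorption against `ψ := 𝟙_S • G_i`.

HONEST SCOPE.  Extraction only; minimality of the limit and energy convergence (the HKL transfer) are (C-b)…(C-e); nothing
of (C), (RS), S1″, S2♭″, `hHalvingBand`, `BlockLipschitzL`, `HistoryTailL` is proved here.  YM₃ on T³ is rung R3, not Clay.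

References: L. Simon, Theorems on Regularity and Singularity of Energy Minimizing Maps (1996) [Simon1996] (§2.9 Lemma 1);
R. Hardt, D. Kinderlehrer, F.-H. Lin, Comm. Math. Phys. 105 (1986) 547–570 [HardtKinderlehrerLin1986]; L. C. Evans,
Partial Differential Equations (2010) [Evans2010] (§5.7, App. D).
-/

set_option autoImplicit false

noncomputable section

open MeasureTheory Set Function Filter Topology Metric TopologicalSpace
open scoped ContDiff ENNReal RealInnerProductSpace BigOperators

namespace Summit.QuantumFields.YangMills.Theorems.PoincareLipschitzSobolevCubeExtraction

open Literature.Analysis.FunctionSpaces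
open Summit.QuantumFields.YangMills.Theorems.PoincareLipschitzSobolevL2Compactness
open Summit.QuantumFields.YangMills.Theorems.PoincareLipschitzDyadicMeansWeakLimitCube
open Summit.QuantumFields.YangMills.Theorems.PoincareLipschitzDyadicMeansWeakLimit (volume_openCube_lt_top
  restrict_openCube_restrict_dyadicCell)
open Summit.QuantumFields.YangMills.Theorems.PoincareLipschitzLatticeToContinuumSobolevLetters
  (exists_unit_representative)
open Summit.QuantumFields.YangMills.Theorems.PoincareLipschitzBlowDownWeakGradientLetters (sum_smulRight_apply
  sum_smulRight_apply_single tendsto_setIntegral_norm_of_sq integrable_of_norm_le)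

open Summit.QuantumFields.YangMills.Theorems.PoincareLipschitzSobolevCubeExtractionLetters

/-! ## §4 Two assembly lemmas: the weak derivative of the limit, lower semicontinuity -/

-- nested operator types `(E →L[ℝ] ℝ) →L[ℝ] F →L[ℝ] E →L[ℝ] F` (`smulRightL`), as in lit `WeakDerivInner`
set_option maxSynthPendingDepth 3 in
/-- **The `L²` limit of unit maps inherits the weak gradient `v ↦ Σ_μ v_μ • G_μ`** when, for every direction `μ` and every
bounded measurable scalar weight `θ`, `∫_Q θ • (Gs_k e_μ) → ∫_Q θ • G_μ` (integration by parts passes to the limit: the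
left sides `∫_Q ∂_μθ • u_k` converge by strong `L²` convergence). [cite: Evans2010, §5.8.2 Theorem 3] -/
theorem hasWeakFDerivOn_of_limit_pairings (hQ : IsOpen {x : EuclideanSpace ℝ (Fin 3) | ∀ i : Fin 3, |x i| < 1})
    {u : ℕ → EuclideanSpace ℝ (Fin 3) → EuclideanSpace ℝ (Fin 4)}
    {Gs : ℕ → EuclideanSpace ℝ (Fin 3) → (EuclideanSpace ℝ (Fin 3) →L[ℝ] EuclideanSpace ℝ (Fin 4))}
    (hu : ∀ k, HasWeakFDerivOn ⟨{x : EuclideanSpace ℝ (Fin 3) | ∀ i : Fin 3, |x i| < 1}, hQ⟩ volume (u k) (Gs k))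
    (hu1 : ∀ k (x : EuclideanSpace ℝ (Fin 3)), (∀ i : Fin 3, |x i| < 1) → ‖u k x‖ = 1)
    {U : EuclideanSpace ℝ (Fin 3) → EuclideanSpace ℝ (Fin 4)} (hUm : Measurable U) (hU1 : ∀ x, ‖U x‖ = 1)
    (hL2 : Tendsto (fun k => ∫ x in {x : EuclideanSpace ℝ (Fin 3) | ∀ i : Fin 3, |x i| < 1}, ‖u k x - U x‖ ^ 2) atTop (𝓝 0))
    {Gc : Fin 3 → EuclideanSpace ℝ (Fin 3) → EuclideanSpace ℝ (Fin 4)}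
    (hGc : ∀ μ, IntegrableOn (Gc μ) {x : EuclideanSpace ℝ (Fin 3) | ∀ i : Fin 3, |x i| < 1} volume)
    (hpair : ∀ (μ : Fin 3) (θ : EuclideanSpace ℝ (Fin 3) → ℝ) (B : ℝ), AEStronglyMeasurable θ (volume.restrict {x : EuclideanSpace ℝ (Fin 3) | ∀ i : Fin 3, |x i| < 1}) →
      (∀ x, |θ x| ≤ B) →
      Tendsto (fun k => ∫ x in {x : EuclideanSpace ℝ (Fin 3) | ∀ i : Fin 3, |x i| < 1}, θ x • Gs k x (EuclideanSpace.single μ (1:ℝ))) atTop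
        (𝓝 (∫ x in {x : EuclideanSpace ℝ (Fin 3) | ∀ i : Fin 3, |x i| < 1}, θ x • Gc μ x))) :
    HasWeakFDerivOn ⟨{x : EuclideanSpace ℝ (Fin 3) | ∀ i : Fin 3, |x i| < 1}, hQ⟩ volume U
      (fun x => ∑ μ : Fin 3, (EuclideanSpace.proj μ).smulRight (Gc μ x)) := by
  set Q : Set (EuclideanSpace ℝ (Fin 3)) := {x | ∀ i : Fin 3, |x i| < 1} with hQdef
  have hQm : MeasurableSet Q := hQ.measurableSet
  have hQfin : volume Q < ⊤ := volume_openCube_lt_top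
  haveI : IsFiniteMeasure (volume.restrict Q) := isFiniteMeasure_restrict.2 hQfin.ne
  have humeas : ∀ k, AEStronglyMeasurable (u k) (volume.restrict Q) :=
    fun k => (hu k).locallyIntegrableOn.aestronglyMeasurable
  have hUint : IntegrableOn U Q volume :=
    integrable_of_norm_le hUm.aestronglyMeasurable 1 (Eventually.of_forall fun x => (hU1 x).le)
  have hG1 : ∀ μ : Fin 3, IntegrableOn (fun x =>
      ((EuclideanSpace.proj μ : EuclideanSpace ℝ (Fin 3) →L[ℝ] ℝ)).smulRight (Gc μ x)) Q volume := by
    intro μ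
    refine Integrable.mono' ((hGc μ).norm.const_mul ‖(EuclideanSpace.proj μ : EuclideanSpace ℝ (Fin 3) →L[ℝ] ℝ)‖) ?_ ?_
    · exact (ContinuousLinearMap.smulRightL ℝ (EuclideanSpace ℝ (Fin 3)) (EuclideanSpace ℝ (Fin 4))
        (EuclideanSpace.proj μ : EuclideanSpace ℝ (Fin 3) →L[ℝ] ℝ)).continuous.comp_aestronglyMeasurable
        (hGc μ).aestronglyMeasurable
    · exact Eventually.of_forall fun x => (ContinuousLinearMap.norm_smulRight_apply _ _).le
  have hGint : IntegrableOn (fun x => ∑ μ : Fin 3,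
      ((EuclideanSpace.proj μ : EuclideanSpace ℝ (Fin 3) →L[ℝ] ℝ)).smulRight (Gc μ x)) Q volume := by
    simp only [Fin.sum_univ_three]
    exact ((hG1 0).add (hG1 1)).add (hG1 2)
  -- integration by parts per direction, in the limit
  have hper : ∀ (μ : Fin 3) (θ : EuclideanSpace ℝ (Fin 3) → ℝ), IsTestFunctionOn ⟨Q, hQ⟩ θ →
      ∫ x in Q, (fderiv ℝ θ x (EuclideanSpace.single μ (1:ℝ))) • U x = -∫ x in Q, θ x • Gc μ x := by
    intro μ θ hθ
    obtain ⟨L', hL'⟩ := (hθ.hasCompactSupport.fderiv (𝕜 := ℝ)).exists_bound_of_continuous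
      ((hθ.contDiff.of_le (by exact_mod_cast le_top) : ContDiff ℝ 1 θ).continuous_fderiv one_ne_zero)
    obtain ⟨B', hB'⟩ := hθ.hasCompactSupport.exists_bound_of_continuous hθ.contDiff.continuous
    have hDc : Continuous fun y => fderiv ℝ θ y (EuclideanSpace.single μ (1:ℝ)) :=
      (((hθ.contDiff.of_le (by exact_mod_cast le_top) : ContDiff ℝ 1 θ)).continuous_fderiv one_ne_zero).clm_apply
        continuous_const
    have hDb : ∀ y, |fderiv ℝ θ y (EuclideanSpace.single μ (1:ℝ))| ≤ L' * ‖EuclideanSpace.single μ (1:ℝ)‖ := fun y => by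
      rw [← Real.norm_eq_abs]
      exact (ContinuousLinearMap.le_opNorm _ _).trans (mul_le_mul_of_nonneg_right (hL' y) (norm_nonneg _))
    have hlhs : Tendsto (fun k => ∫ x in Q, (fderiv ℝ θ x (EuclideanSpace.single μ (1:ℝ))) • u k x) atTop
        (𝓝 (∫ x in Q, (fderiv ℝ θ x (EuclideanSpace.single μ (1:ℝ))) • U x)) :=
      tendsto_setIntegral_smul_of_sq hQfin hQm hDc.aestronglyMeasurable hDb humeas hUm.aestronglyMeasurable
        (fun k x hx => (hu1 k x hx).le) (fun x => (hU1 x).le) hL2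
    have hrhs : Tendsto (fun k => -∫ x in Q, θ x • Gs k x (EuclideanSpace.single μ (1:ℝ))) atTop
        (𝓝 (-∫ x in Q, θ x • Gc μ x)) :=
      (hpair μ θ B' hθ.contDiff.continuous.aestronglyMeasurable fun x => by
        rw [← Real.norm_eq_abs]; exact hB' x).neg
    have heq : ∀ k, ∫ x in Q, (fderiv ℝ θ x (EuclideanSpace.single μ (1:ℝ))) • u k x =
        -∫ x in Q, θ x • Gs k x (EuclideanSpace.single μ (1:ℝ)) :=
      fun k => (hu k).integral_fderiv_smul_eq θ (EuclideanSpace.single μ (1:ℝ)) hθ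
    exact tendsto_nhds_unique hlhs (by simp_rw [heq]; exact hrhs)
  refine ⟨hUint.locallyIntegrableOn, hGint.locallyIntegrableOn, fun θ v hθ => ?_⟩
  have hv : v = ∑ μ : Fin 3, v μ • EuclideanSpace.single μ (1:ℝ) := by
    simpa using ((EuclideanSpace.basisFun (Fin 3) ℝ).sum_repr v).symm
  have hlhs : ∀ x, (fderiv ℝ θ x v) • U x =
      ∑ μ : Fin 3, v μ • ((fderiv ℝ θ x (EuclideanSpace.single μ (1:ℝ))) • U x) := by
    intro x
    conv_lhs => rw [hv]
    rw [map_sum, Finset.sum_smul]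
    refine Finset.sum_congr rfl fun μ _ => ?_
    rw [map_smul, smul_eq_mul, mul_smul]
  have hrhs : ∀ x, θ x • (∑ μ : Fin 3, (EuclideanSpace.proj μ).smulRight (Gc μ x)) v =
      ∑ μ : Fin 3, v μ • (θ x • Gc μ x) := by
    intro x
    rw [sum_smulRight_apply, Finset.smul_sum]
    refine Finset.sum_congr rfl fun μ _ => ?_
    rw [smul_comm]
  obtain ⟨L', hL'⟩ := (hθ.hasCompactSupport.fderiv (𝕜 := ℝ)).exists_bound_of_continuous
    ((hθ.contDiff.of_le (by exact_mod_cast le_top) : ContDiff ℝ 1 θ).continuous_fderiv one_ne_zero)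
  have hDc : ∀ μ : Fin 3, Continuous fun y => fderiv ℝ θ y (EuclideanSpace.single μ (1:ℝ)) := fun μ =>
    (((hθ.contDiff.of_le (by exact_mod_cast le_top) : ContDiff ℝ 1 θ)).continuous_fderiv one_ne_zero).clm_apply
      continuous_const
  have hI1 : ∀ μ : Fin 3, Integrable (fun x => (fderiv ℝ θ x (EuclideanSpace.single μ (1:ℝ))) • U x)
      (volume.restrict Q) := by
    intro μ
    refine integrable_of_norm_le ((hDc μ).aestronglyMeasurable.smul hUm.aestronglyMeasurable)
      (L' * ‖EuclideanSpace.single μ (1:ℝ)‖) (Eventually.of_forall fun y => ?_)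
    rw [norm_smul, hU1 y, mul_one]
    exact (ContinuousLinearMap.le_opNorm _ _).trans (mul_le_mul_of_nonneg_right (hL' y) (norm_nonneg _))
  have hI2 : ∀ μ : Fin 3, Integrable (fun x => θ x • Gc μ x) (volume.restrict Q) := fun μ =>
    integrableOn_smul_of_tsupport_subset (Ω := ⟨Q, hQ⟩) hθ.contDiff.continuous hθ.hasCompactSupport
      hθ.tsupport_subset (hGc μ).locallyIntegrableOn
  show ∫ x in Q, (fderiv ℝ θ x v) • U x = -∫ x in Q, θ x • (∑ μ : Fin 3, (EuclideanSpace.proj μ).smulRight (Gc μ x)) v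
  simp_rw [hlhs, hrhs]
  have hs1 : ∫ x in Q, ∑ μ : Fin 3, v μ • ((fderiv ℝ θ x (EuclideanSpace.single μ (1:ℝ))) • U x) =
      ∑ μ : Fin 3, ∫ x in Q, v μ • ((fderiv ℝ θ x (EuclideanSpace.single μ (1:ℝ))) • U x) :=
    integral_finsetSum _ fun μ _ => (hI1 μ).smul (v μ)
  have hs2 : ∫ x in Q, ∑ μ : Fin 3, v μ • (θ x • Gc μ x) = ∑ μ : Fin 3, ∫ x in Q, v μ • (θ x • Gc μ x) :=
    integral_finsetSum _ fun μ _ => (hI2 μ).smul (v μ)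
  rw [hs1, hs2, ← Finset.sum_neg_distrib]
  refine Finset.sum_congr rfl fun μ _ => ?_
  rw [integral_smul, integral_smul, hper μ θ hθ, smul_neg]

/-- **Lower semicontinuity of the energy under weak `L²` convergence of the components, by Cauchy–Schwarz absorption**:
if `∫_Q ⟪ψ, v_k^i⟫ → ∫_Q ⟪ψ, G_i⟫` for all `ψ ∈ L²(Q)` and `∫_S Σ_i ‖v_k^i‖² ≤ M` for infinitely many `k` (`S ⊆ Q`
measurable), then `Σ_i ∫_S ‖G_i‖² ≤ M` (test with `ψ := 1_S G_i`: the limit `a` obeys `a ≤ (a + M)/2`). [folklore] -/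
theorem sum_setIntegral_sq_le_of_weak_pairing
    {Gc : Fin 3 → EuclideanSpace ℝ (Fin 3) → EuclideanSpace ℝ (Fin 4)}
    (hGcMem : ∀ i, MemLp (Gc i) 2 (volume.restrict {x : EuclideanSpace ℝ (Fin 3) | ∀ i : Fin 3, |x i| < 1}))
    {v : ℕ → Fin 3 → EuclideanSpace ℝ (Fin 3) → EuclideanSpace ℝ (Fin 4)}
    (hvMem : ∀ k i, MemLp (v k i) 2 (volume.restrict {x : EuclideanSpace ℝ (Fin 3) | ∀ i : Fin 3, |x i| < 1}))
    (hGcψ : ∀ (i : Fin 3) (ψ : EuclideanSpace ℝ (Fin 3) → EuclideanSpace ℝ (Fin 4)),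
      MemLp ψ 2 (volume.restrict {x : EuclideanSpace ℝ (Fin 3) | ∀ i : Fin 3, |x i| < 1}) →
      Tendsto (fun k => ∫ x in {x : EuclideanSpace ℝ (Fin 3) | ∀ i : Fin 3, |x i| < 1}, ⟪ψ x, v k i x⟫) atTop (𝓝 (∫ x in {x : EuclideanSpace ℝ (Fin 3) | ∀ i : Fin 3, |x i| < 1}, ⟪ψ x, Gc i x⟫)))
    {S : Set (EuclideanSpace ℝ (Fin 3))} (hS : MeasurableSet S) (hSQ : S ⊆ {x : EuclideanSpace ℝ (Fin 3) | ∀ i : Fin 3, |x i| < 1}) {M : ℝ}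
    (hM : ∃ᶠ k in atTop, ∫ x in S, ∑ i : Fin 3, ‖v k i x‖ ^ 2 ≤ M) :
    ∑ i : Fin 3, ∫ x in S, ‖Gc i x‖ ^ 2 ≤ M := by
  set Q : Set (EuclideanSpace ℝ (Fin 3)) := {x | ∀ i : Fin 3, |x i| < 1} with hQdef
  have hνle : volume.restrict S ≤ volume.restrict Q := Measure.restrict_mono hSQ le_rfl
  have hGci2 : ∀ i, Integrable (fun x => ‖Gc i x‖ ^ 2) (volume.restrict Q) := fun i =>
    (memLp_two_iff_integrable_sq_norm (hGcMem i).1).1 (hGcMem i)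
  have hv2 : ∀ k i, Integrable (fun x => ‖v k i x‖ ^ 2) (volume.restrict Q) := fun k i =>
    (memLp_two_iff_integrable_sq_norm (hvMem k i).1).1 (hvMem k i)
  have hGcS2 : ∀ i, Integrable (fun x => ‖Gc i x‖ ^ 2) (volume.restrict S) := fun i => (hGci2 i).mono_measure hνle
  have hvS2 : ∀ k i, Integrable (fun x => ‖v k i x‖ ^ 2) (volume.restrict S) :=
    fun k i => (hv2 k i).mono_measure hνle
  have hGcSm : ∀ i, AEStronglyMeasurable (Gc i) (volume.restrict S) := fun i => (hGcMem i).1.mono_measure hνle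
  have hvSm : ∀ k i, AEStronglyMeasurable (v k i) (volume.restrict S) := fun k i => (hvMem k i).1.mono_measure hνle
  -- the pairings `∫_S ⟪Gc i, v_k^i⟫ → ∫_S ‖Gc i‖²`
  have hpair : ∀ i, Tendsto (fun k => ∫ x in S, ⟪Gc i x, v k i x⟫) atTop (𝓝 (∫ x in S, ‖Gc i x‖ ^ 2)) := by
    intro i
    have h := hGcψ i (S.indicator (Gc i)) ((hGcMem i).indicator hS)
    have h1 : ∀ (w : EuclideanSpace ℝ (Fin 3) → EuclideanSpace ℝ (Fin 4)),
        ∫ x in Q, ⟪S.indicator (Gc i) x, w x⟫ = ∫ x in S, ⟪Gc i x, w x⟫ := by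
      intro w
      have h2 : (fun x => ⟪S.indicator (Gc i) x, w x⟫) = S.indicator (fun x => ⟪Gc i x, w x⟫) := by
        funext x
        by_cases hx : x ∈ S
        · rw [Set.indicator_of_mem hx, Set.indicator_of_mem hx]
        · rw [Set.indicator_of_notMem hx, Set.indicator_of_notMem hx, inner_zero_left]
      rw [h2, setIntegral_indicator hS, inter_eq_self_of_subset_right hSQ]
    have h3 : ∫ x in S, ⟪Gc i x, Gc i x⟫ = ∫ x in S, ‖Gc i x‖ ^ 2 := by
      refine integral_congr_ae (Eventually.of_forall fun x => ?_)
      simp only [real_inner_self_eq_norm_sq]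
    rw [h1 (Gc i), h3] at h
    exact h.congr fun k => h1 (v k i)
  have hsum : Tendsto (fun k => ∑ i : Fin 3, ∫ x in S, ⟪Gc i x, v k i x⟫) atTop
      (𝓝 (∑ i : Fin 3, ∫ x in S, ‖Gc i x‖ ^ 2)) := tendsto_finsetSum _ fun i _ => hpair i
  -- the absorption bound, frequently
  have hbound : ∃ᶠ k in atTop, ∑ i : Fin 3, ∫ x in S, ⟪Gc i x, v k i x⟫ ≤
      ((∑ i : Fin 3, ∫ x in S, ‖Gc i x‖ ^ 2) + M) / 2 := by
    refine hM.mono fun k hk => ?_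
    have h1 : ∀ i, ∫ x in S, ⟪Gc i x, v k i x⟫ ≤ ∫ x in S, (‖Gc i x‖ ^ 2 + ‖v k i x‖ ^ 2) / 2 := fun i =>
      integral_mono (integrable_real_inner_of_sq (hGcSm i) (hvSm k i) (hGcS2 i) (hvS2 k i))
        (((hGcS2 i).add (hvS2 k i)).div_const 2) fun x => by
          have := real_inner_le_norm (Gc i x) (v k i x)
          nlinarith [sq_nonneg (‖Gc i x‖ - ‖v k i x‖)]
    have h2 : ∀ i, ∫ x in S, (‖Gc i x‖ ^ 2 + ‖v k i x‖ ^ 2) / 2 =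
        ((∫ x in S, ‖Gc i x‖ ^ 2) + ∫ x in S, ‖v k i x‖ ^ 2) / 2 := fun i => by
      rw [integral_div, integral_add (hGcS2 i) (hvS2 k i)]
    have h3 : ∑ i : Fin 3, ∫ x in S, ‖v k i x‖ ^ 2 = ∫ x in S, ∑ i : Fin 3, ‖v k i x‖ ^ 2 :=
      (integral_finsetSum _ fun i _ => hvS2 k i).symm
    have h4 : ∑ i : Fin 3, ∫ x in S, ⟪Gc i x, v k i x⟫ ≤
        ∑ i : Fin 3, ((∫ x in S, ‖Gc i x‖ ^ 2) + ∫ x in S, ‖v k i x‖ ^ 2) / 2 :=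
      Finset.sum_le_sum fun i _ => (h1 i).trans (le_of_eq (h2 i))
    rw [← Finset.sum_div, Finset.sum_add_distrib, h3] at h4
    linarith
  have hle := isClosed_Iic.mem_of_frequently_of_tendsto hbound hsum
  rw [mem_Iic] at hle
  linarith

/-! ## §5 The extraction theorem on the cube -/

/-- ★★★ **(C-a3) EXTRACTION ON THE CUBE.**  Let `u_j : Q → S³ ⊂ ℝ⁴` (`Q` the open unit cube of `ℝ³`) have weak gradients
`Gs_j` on `Q` with `∫_Q Σ_i ‖Gs_j e_i‖² ≤ Λ`.  Then along a subsequence `φ` there are a measurable, everywhere-unit `U` and a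
field `G` with: `U` has weak gradient `G` on `Q` (lit `HasWeakFDerivOn`); `Σ_i ‖G e_i‖²` is integrable on `Q`; `u_{φ j} → U`
a.e. on `Q` and in `L²(Q)`; the components `Gs_{φ j} e_i ⇀ G e_i` weakly in `L²(Q; ℝ⁴)`; and the energy is lower
semicontinuous on every measurable `S ⊆ Q`: if `∫_S Σ_i ‖Gs_{φ j} e_i‖² ≤ M` for infinitely many `j` then
`∫_S Σ_i ‖G e_i‖² ≤ M`.  (Rellich via (C-a1)/(C-a2), Cantor diagonal on the dyadic means, w8's (Γ2-W) weak limit per direction,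
integration by parts in the limit, Cauchy–Schwarz absorption.) [cite: Evans2010, §5.7 Theorem 1; §5.8.2 Theorem 3] -/
theorem exists_subseq_limit_weakGrad (hQ : IsOpen {x : EuclideanSpace ℝ (Fin 3) | ∀ i : Fin 3, |x i| < 1})
    (u : ℕ → EuclideanSpace ℝ (Fin 3) → EuclideanSpace ℝ (Fin 4))
    (Gs : ℕ → EuclideanSpace ℝ (Fin 3) → (EuclideanSpace ℝ (Fin 3) →L[ℝ] EuclideanSpace ℝ (Fin 4))) (Λ : ℝ)
    (hu : ∀ j, HasWeakFDerivOn ⟨{x : EuclideanSpace ℝ (Fin 3) | ∀ i : Fin 3, |x i| < 1}, hQ⟩ volume (u j) (Gs j))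
    (hu1 : ∀ j (x : EuclideanSpace ℝ (Fin 3)), (∀ i : Fin 3, |x i| < 1) → ‖u j x‖ = 1)
    (hGi : ∀ j, IntegrableOn (fun x => ∑ i : Fin 3, ‖Gs j x (EuclideanSpace.single i (1:ℝ))‖ ^ 2) {x : EuclideanSpace ℝ (Fin 3) | ∀ i : Fin 3, |x i| < 1} volume)
    (hΛ : ∀ j, ∫ x in {x : EuclideanSpace ℝ (Fin 3) | ∀ i : Fin 3, |x i| < 1}, ∑ i : Fin 3, ‖Gs j x (EuclideanSpace.single i (1:ℝ))‖ ^ 2 ≤ Λ) :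
    ∃ (U : EuclideanSpace ℝ (Fin 3) → EuclideanSpace ℝ (Fin 4))
      (G : EuclideanSpace ℝ (Fin 3) → (EuclideanSpace ℝ (Fin 3) →L[ℝ] EuclideanSpace ℝ (Fin 4))) (φ : ℕ → ℕ),
      StrictMono φ ∧ Measurable U ∧
      HasWeakFDerivOn ⟨{x : EuclideanSpace ℝ (Fin 3) | ∀ i : Fin 3, |x i| < 1}, hQ⟩ volume U G ∧
      (∀ x, ‖U x‖ = 1) ∧
      IntegrableOn (fun x => ∑ i : Fin 3, ‖G x (EuclideanSpace.single i (1:ℝ))‖ ^ 2) {x : EuclideanSpace ℝ (Fin 3) | ∀ i : Fin 3, |x i| < 1} volume ∧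
      (∀ᵐ x ∂(volume.restrict {x : EuclideanSpace ℝ (Fin 3) | ∀ i : Fin 3, |x i| < 1}), Tendsto (fun j => u (φ j) x) atTop (𝓝 (U x))) ∧
      Tendsto (fun j => ∫ x in {x : EuclideanSpace ℝ (Fin 3) | ∀ i : Fin 3, |x i| < 1}, ‖u (φ j) x - U x‖ ^ 2) atTop (𝓝 0) ∧
      (∀ (i : Fin 3) (ψ : EuclideanSpace ℝ (Fin 3) → EuclideanSpace ℝ (Fin 4)), MemLp ψ 2 (volume.restrict {x : EuclideanSpace ℝ (Fin 3) | ∀ i : Fin 3, |x i| < 1}) →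
        Tendsto (fun j => ∫ x in {x : EuclideanSpace ℝ (Fin 3) | ∀ i : Fin 3, |x i| < 1}, ⟪ψ x, Gs (φ j) x (EuclideanSpace.single i (1:ℝ))⟫) atTop
          (𝓝 (∫ x in {x : EuclideanSpace ℝ (Fin 3) | ∀ i : Fin 3, |x i| < 1}, ⟪ψ x, G x (EuclideanSpace.single i (1:ℝ))⟫))) ∧
      (∀ S : Set (EuclideanSpace ℝ (Fin 3)), MeasurableSet S → S ⊆ {x : EuclideanSpace ℝ (Fin 3) | ∀ i : Fin 3, |x i| < 1} →
        ∀ M : ℝ, (∃ᶠ j in atTop, ∫ x in S, ∑ i : Fin 3, ‖Gs (φ j) x (EuclideanSpace.single i (1:ℝ))‖ ^ 2 ≤ M) →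
          ∫ x in S, ∑ i : Fin 3, ‖G x (EuclideanSpace.single i (1:ℝ))‖ ^ 2 ≤ M) := by
  set Q : Set (EuclideanSpace ℝ (Fin 3)) := {x | ∀ i : Fin 3, |x i| < 1} with hQdef
  have hQm : MeasurableSet Q := hQ.measurableSet
  have hQfin : volume Q < ⊤ := volume_openCube_lt_top
  haveI : IsFiniteMeasure (volume.restrict Q) := isFiniteMeasure_restrict.2 hQfin.ne
  -- §2: strong `L²` limit with a unit representative
  obtain ⟨U, φ₁, hφ₁, hUm, hU1, hae₁, hL2₁⟩ := exists_subseq_unit_limit hQ u Gs Λ hu hu1 hGi hΛ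
  -- the components of the gradients lie in `L²(Q; ℝ⁴)` with `∫_Q ‖·‖² ≤ Λ`
  have hvm : ∀ j i, AEStronglyMeasurable (fun x => Gs j x (EuclideanSpace.single i (1:ℝ))) (volume.restrict Q) :=
    fun j i => (hu j).aestronglyMeasurable_deriv_apply (EuclideanSpace.single i (1:ℝ))
  have hv_le : ∀ j i x, ‖Gs j x (EuclideanSpace.single i (1:ℝ))‖ ^ 2 ≤
      ∑ i' : Fin 3, ‖Gs j x (EuclideanSpace.single i' (1:ℝ))‖ ^ 2 := fun j i x =>
    Finset.single_le_sum (f := fun i' => ‖Gs j x (EuclideanSpace.single i' (1:ℝ))‖ ^ 2) (fun i' _ => sq_nonneg _)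
      (Finset.mem_univ i)
  have hv2 : ∀ j i, Integrable (fun x => ‖Gs j x (EuclideanSpace.single i (1:ℝ))‖ ^ 2) (volume.restrict Q) :=
    fun j i => (hGi j).mono' ((hvm j i).norm.pow 2) (Eventually.of_forall fun x => by
      rw [Real.norm_eq_abs, abs_of_nonneg (sq_nonneg _)]; exact hv_le j i x)
  have hvMem : ∀ j i, MemLp (fun x => Gs j x (EuclideanSpace.single i (1:ℝ))) 2 (volume.restrict Q) := fun j i =>
    (memLp_two_iff_integrable_sq_norm (hvm j i)).2 (hv2 j i)
  have hvΛ : ∀ j i, ∫ x in Q, ‖Gs j x (EuclideanSpace.single i (1:ℝ))‖ ^ 2 ≤ Λ := fun j i =>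
    (integral_mono (hv2 j i) (hGi j) fun x => hv_le j i x).trans (hΛ j)
  -- the dyadic means are bounded by `R := vol(Q) + Λ`
  set R : ℝ := volume.real Q + Λ with hR
  have hL1 : ∀ j i, ∫ x in Q, ‖Gs j x (EuclideanSpace.single i (1:ℝ))‖ ≤ R := by
    intro j i
    have hpt : ∀ x, ‖Gs j x (EuclideanSpace.single i (1:ℝ))‖ ≤ 1 + ‖Gs j x (EuclideanSpace.single i (1:ℝ))‖ ^ 2 :=
      fun x => by
        nlinarith [norm_nonneg (Gs j x (EuclideanSpace.single i (1:ℝ))),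
          sq_nonneg (‖Gs j x (EuclideanSpace.single i (1:ℝ))‖ - 1)]
    calc ∫ x in Q, ‖Gs j x (EuclideanSpace.single i (1:ℝ))‖
        ≤ ∫ x in Q, (1 + ‖Gs j x (EuclideanSpace.single i (1:ℝ))‖ ^ 2) :=
          integral_mono_of_nonneg (Eventually.of_forall fun x => norm_nonneg _)
            ((integrable_const _).add (hv2 j i)) (Eventually.of_forall hpt)
      _ = volume.real Q + ∫ x in Q, ‖Gs j x (EuclideanSpace.single i (1:ℝ))‖ ^ 2 := by
          rw [integral_add (integrable_const _) (hv2 j i), setIntegral_const, smul_eq_mul, mul_one]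
      _ ≤ R := add_le_add le_rfl (hvΛ j i)
  have hcell : ∀ (j : ℕ) (i : Fin 3) (m : ℕ) (c : Fin 3 → Fin (2 ^ m)),
      ‖∫ x in {x : EuclideanSpace ℝ (Fin 3) | ∀ l : Fin 3,
        (-1 : ℝ) + 2 * (c l : ℕ) / (2 : ℝ) ^ m ≤ x l ∧ x l < (-1 : ℝ) + 2 * ((c l : ℕ) + 1) / (2 : ℝ) ^ m},
        Gs j x (EuclideanSpace.single i (1:ℝ))‖ ≤ R := by
    intro j i m c
    rw [← restrict_openCube_restrict_dyadicCell m c]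
    calc ‖∫ x, Gs j x (EuclideanSpace.single i (1:ℝ)) ∂((volume.restrict Q).restrict _)‖
        ≤ ∫ x, ‖Gs j x (EuclideanSpace.single i (1:ℝ))‖ ∂((volume.restrict Q).restrict _) :=
          norm_integral_le_integral_norm _
      _ ≤ ∫ x in Q, ‖Gs j x (EuclideanSpace.single i (1:ℝ))‖ := integral_mono_measure Measure.restrict_le_self
          (Eventually.of_forall fun x => norm_nonneg _) ((hvMem j i).integrable one_le_two).norm
      _ ≤ R := hL1 j i
  -- Cantor diagonal: a further subsequence along which every dyadic mean of every component converges
  obtain ⟨ψ, hψ, hψlim⟩ := exists_strictMono_forall_tendsto (ι := Fin 3 × ((m : ℕ) × (Fin 3 → Fin (2 ^ m))))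
    (F := EuclideanSpace ℝ (Fin 4))
    (fun k p => ∫ x in {x : EuclideanSpace ℝ (Fin 3) | ∀ l : Fin 3,
      (-1 : ℝ) + 2 * (p.2.2 l : ℕ) / (2 : ℝ) ^ p.2.1 ≤ x l ∧ x l < (-1 : ℝ) + 2 * ((p.2.2 l : ℕ) + 1) / (2 : ℝ) ^ p.2.1},
      Gs (φ₁ k) x (EuclideanSpace.single p.1 (1:ℝ)))
    (fun p => ⟨0, R, fun k => by rw [mem_closedBall, dist_zero_right]; exact hcell _ _ _ _⟩)
  set φ : ℕ → ℕ := φ₁ ∘ ψ with hφdef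
  have hφ : StrictMono φ := hφ₁.comp hψ
  -- (Γ2-W) per direction
  choose Gc hGcMem hGcΛ hGcMean hGcψ hGcφ using fun i : Fin 3 =>
    exists_weakLimit_of_dyadicMeans (fun k x => Gs (φ k) x (EuclideanSpace.single i (1:ℝ))) (fun k => hvMem (φ k) i) Λ
      (fun k => hvΛ (φ k) i) (fun m c => hψlim ⟨i, m, c⟩)
  -- the bundled gradient
  set G : EuclideanSpace ℝ (Fin 3) → (EuclideanSpace ℝ (Fin 3) →L[ℝ] EuclideanSpace ℝ (Fin 4)) :=
    fun x => ∑ μ : Fin 3, (EuclideanSpace.proj μ).smulRight (Gc μ x) with hGdef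
  have hGe : ∀ x i, G x (EuclideanSpace.single i (1:ℝ)) = Gc i x := fun x i => sum_smulRight_apply_single Gc x i
  have hGci2 : ∀ i, Integrable (fun x => ‖Gc i x‖ ^ 2) (volume.restrict Q) := fun i =>
    (memLp_two_iff_integrable_sq_norm (hGcMem i).1).1 (hGcMem i)
  -- rows along `φ`
  have hae : ∀ᵐ x ∂(volume.restrict Q), Tendsto (fun j => u (φ j) x) atTop (𝓝 (U x)) := by
    filter_upwards [hae₁] with x hx using hx.comp hψ.tendsto_atTop
  have hL2 : Tendsto (fun j => ∫ x in Q, ‖u (φ j) x - U x‖ ^ 2) atTop (𝓝 0) := hL2₁.comp hψ.tendsto_atTop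
  -- the weak derivative of `U` (§4)
  have hW : HasWeakFDerivOn ⟨Q, hQ⟩ volume U G :=
    hasWeakFDerivOn_of_limit_pairings hQ (fun k => hu (φ k)) (fun k x hx => hu1 (φ k) x hx) hUm hU1 hL2
      (fun μ => (hGcMem μ).integrable one_le_two) hGcφ
  -- the density of `G` is integrable
  have hGdens : IntegrableOn (fun x => ∑ i : Fin 3, ‖G x (EuclideanSpace.single i (1:ℝ))‖ ^ 2) Q volume := by
    simp_rw [hGe]
    exact integrable_finsetSum _ fun i _ => hGci2 i
  refine ⟨U, G, φ, hφ, hUm, hW, hU1, hGdens, hae, hL2, fun i ψ' hψ' => ?_, fun S hS hSQ M hM => ?_⟩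
  · -- weak convergence of the components
    simp_rw [hGe]
    exact hGcψ i ψ' hψ'
  · -- lower semicontinuity on `S ⊆ Q` (§4)
    have ha : ∫ x in S, ∑ i : Fin 3, ‖G x (EuclideanSpace.single i (1:ℝ))‖ ^ 2 = ∑ i : Fin 3, ∫ x in S, ‖Gc i x‖ ^ 2 := by
      simp_rw [hGe]
      exact integral_finsetSum _ fun i _ => (hGci2 i).mono_measure (Measure.restrict_mono hSQ le_rfl)
    rw [ha]
    exact sum_setIntegral_sq_le_of_weak_pairing hGcMem (v := fun k i x => Gs (φ k) x (EuclideanSpace.single i (1:ℝ)))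
      (fun k i => hvMem (φ k) i) hGcψ hS hSQ hM

end Summit.QuantumFields.YangMills.Theorems.PoincareLipschitzSobolevCubeExtraction

end
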